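import Summits.NavierStokesRegularity.NavierStokesRegularity.Theorems.CoriolisHeadFarFieldLimitTools
import HarnessLib

/-!
# CoriolisHeadFarFieldGradientLimit — crux `NoCoRotatingCore` (stmt-NavierStokesRegularity-22676), line
# `far_field_constancy` v2 (skeleton 15c9a82ad206abb9): the pressure gradient of a bounded rotated profile with
# scale-natural derivative decay CONVERGES at infinity (exposed as a reusable statement)

Setting as in `CoriolisHeadFarFieldLimitTools.lean`: a bounded smooth solution `(U, P)` of the rotated Leray profile
system `−νΔU + aU + a(y·∇)U + (BU − (By·∇)U) + (U·∇)U + ∇P = 0`, `div U = 0` (`ν, a > 0`, `B` skew) with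
scale-natural derivative decay `‖y‖‖DU(y)‖ + ‖y‖²‖D²U(y)‖ → 0` (hypothesis K1a of the line).

`FarFieldLimit.exists_gradient_pressure_limit`: **there is `g ∈ ℝ³` with `∇P(y) → g` uniformly as `‖y‖ → ∞`.**
The dyadic vector shell means `M_k = ∫ λ^{2^kR₁,2^{k+1}R₁} • ∇P` satisfy `‖M_k − M_{k+1}‖ ≤ A/(2^kR₁)` by the landed
SHELL-MEAN LEMMA of this line (`shellMean_sub_shellMean_le`, `Theorems/CoriolisHeadFarFieldShellMean.lean`, seat
ns-s29-p2; input `|ΔP| ≤ 3/‖z‖²` from the Tools file), hence converge to some `g`; and `‖∇P(y) − M_k‖ ≤ Λ₁C_osc δ`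
for `y` in the `k`-th shell (`abs_shellMean_sub_le` + the shell oscillation of `∂ₑP` from the Tools file), with
`δ → 0` as the shell recedes — the mean-value/Liouville mechanism of Gilbarg–Trudinger §2.7 run with a decaying
(not vanishing) Laplacian; no Newtonian potential of `ΔP` is formed (it need not converge).

Why a separate file: K1b (`stub_farFieldLimit`, `U → b`) was landed by seat ns-s29-p2 in
`Theorems/CoriolisHeadFarFieldLimit.lean` (p613432) with `∇P`'s convergence internal to its proof; the K1c programme
(`Theorems/CoriolisHeadTypeIRate*.lean`: K1c ⇐ a power rate for `∇P − g`) needs the limit `g` of `∇P` as a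
named statement — this is it (an independent proof of the same convergence).  Everything is proved; no definitions,
no named facts.  WHAT THIS IS NOT: K1a, K1c, `NoCoRotatingCore`, Pineau–Vicol's Conjecture 1.1 and Navier–Stokes
regularity stay OPEN.

References: D. Gilbarg, N. S. Trudinger, *Elliptic PDE of second order* (2001), §2.7 [GilbargTrudinger2001];
B. Pineau, V. Vicol, arXiv:2607.09619 (2026), (1.8) [PineauVicol2026].
-/

noncomputable section

open MeasureTheory Set Function Filter Topology Metric InnerProductSpace Real
open scoped RealInnerProductSpace Laplacian ContDiff

-- the summit and its single sub-problem share the name (CONVENTIONS §1), as in every Theorems file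
set_option linter.dupNamespace false

namespace Summit.NavierStokesRegularity.NavierStokesRegularity.Theorems.CoriolisHead

namespace FarFieldLimit

open Literature.Analysis.FluidPDE

section Profile

variable {ν a : ℝ} {B : EuclideanSpace ℝ (Fin 3) →L[ℝ] EuclideanSpace ℝ (Fin 3)}
  {U : EuclideanSpace ℝ (Fin 3) → EuclideanSpace ℝ (Fin 3)} {P : EuclideanSpace ℝ (Fin 3) → ℝ}

/-! ## §4 Convergence of the pressure gradient -/

/-- **The pressure gradient of a bounded rotated profile with scale-natural derivative decay converges
at infinity**: there is `g ∈ ℝ³` with `∀ ε > 0 ∃ R ∀ y, R ≤ ‖y‖ → ‖∇P(y) − g‖ ≤ ε`.  Proof: the dyadic vector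
shell means `M_k = ∫ λ^{2^kR₁, 2^{k+1}R₁} • ∇P` are Cauchy by the shell-mean lemma (`|ΔP| ≤ 3/‖z‖²` beyond
`R₁`), and `∇P(y)` is within `Λ₁ C_osc δ` of `M_k` on the `k`-th shell once the shell is far out.
[cite: GilbargTrudinger2001, §2.7 (Liouville via mean values)] -/
theorem exists_gradient_pressure_limit (hν : 0 < ν) (ha : 0 < a)
    (hB : ∀ x, inner ℝ (B x) x = 0) (hU : ContDiff ℝ ∞ U) (hP : ContDiff ℝ 2 P)
    (hdiv : VectorCalculus.IsDivFree U)
    (heq : ∀ y, -(ν • (Δ U) y) + a • U y + a • fderiv ℝ U y y + (B (U y) - fderiv ℝ U y (B y)) +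
      convect U U y + gradient P y = 0)
    (hbdd : ∃ M : ℝ, ∀ y, ‖U y‖ ≤ M)
    (hdecay : ∀ ε : ℝ, 0 < ε → ∃ R : ℝ, ∀ y : EuclideanSpace ℝ (Fin 3), R ≤ ‖y‖ →
      ‖y‖ * ‖fderiv ℝ U y‖ + ‖y‖ ^ 2 * ‖iteratedFDeriv ℝ 2 U y‖ ≤ ε) :
    ∃ g : EuclideanSpace ℝ (Fin 3), ∀ ε : ℝ, 0 < ε → ∃ R : ℝ, ∀ y : EuclideanSpace ℝ (Fin 3),
      R ≤ ‖y‖ → ‖gradient P y - g‖ ≤ ε := by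
  obtain ⟨M, hM⟩ := hbdd
  have hM0 : 0 ≤ M := (norm_nonneg _).trans (hM 0)
  have hU2 : ContDiff ℝ 2 U := hU.of_le (by norm_cast)
  have hU3 : ContDiff ℝ 3 U := hU.of_le (by norm_cast)
  have hP1 : ContDiff ℝ 1 P := hP.of_le one_le_two
  have hPinf : ContDiff ℝ ∞ P := contDiff_pressure_of_rotated hU hP1 heq
  -- the radius for `δ = 1`: the Laplacian bound `|ΔP| ≤ 3/‖z‖²`
  obtain ⟨R₁, hR₁1, hR₁⟩ := exists_radius_decay hdecay one_pos
  have hR₁pos : 0 < R₁ := one_pos.trans_le hR₁1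
  have hΔP : ∀ z : EuclideanSpace ℝ (Fin 3), R₁ ≤ ‖z‖ → |(Δ P) z| ≤ 3 / ‖z‖ ^ 2 := fun z hz => by
    have h := abs_laplacian_pressure_le hU3 hP hdiv heq hR₁ z hz
    rwa [one_pow, mul_one] at h
  obtain ⟨CΓ, hCΓ0, hCΓ⟩ := exists_sq_mul_norm_fderiv_newtonFar_le
  -- dyadic radii and the vector shell means
  obtain ⟨r, hr⟩ : ∃ r : ℕ → ℝ, ∀ k, r k = 2 ^ k * R₁ := ⟨fun k => 2 ^ k * R₁, fun _ => rfl⟩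
  have hrpos : ∀ k, 0 < r k := fun k => by rw [hr]; positivity
  have hrR₁ : ∀ k, R₁ ≤ r k := fun k => by
    rw [hr]; exact le_mul_of_one_le_left hR₁pos.le (one_le_pow₀ one_le_two)
  have hrsucc : ∀ k, r (k + 1) = 2 * r k := fun k => by rw [hr, hr, pow_succ]; ring
  obtain ⟨Mv, hMv⟩ : ∃ Mv : ℕ → EuclideanSpace ℝ (Fin 3),
      ∀ k, Mv k = ∫ z, newtonFarLaplacian (r k) (2 * r k) z • gradient P z := ⟨_, fun _ => rfl⟩
  have hcomp : ∀ k (e : EuclideanSpace ℝ (Fin 3)),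
      ⟪Mv k, e⟫ = ∫ z, newtonFarLaplacian (r k) (2 * r k) z * fderiv ℝ P z e := fun k e => by
    rw [hMv]; exact inner_shellMean_gradient (hrpos k) hP1 e
  -- Step 1: the shell-mean lemma, componentwise, then as a vector bound
  obtain ⟨A, hA0, hAstep⟩ : ∃ A : ℝ, 0 ≤ A ∧ ∀ (k : ℕ) (e : EuclideanSpace ℝ (Fin 3)),
      |(∫ z, newtonFarLaplacian (r k) (2 * r k) z * fderiv ℝ P z e) -
        (∫ z, newtonFarLaplacian (r (k + 1)) (2 * r (k + 1)) z * fderiv ℝ P z e)| ≤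
        A * ‖e‖ / r k := by
    refine ⟨128 * (volume (ball (0 : EuclideanSpace ℝ (Fin 3)) 1)).toReal * CΓ * 3, by positivity,
      fun k e => ?_⟩
    have h := shellMean_sub_shellMean_le hCΓ0 hCΓ hPinf (K := 3) (by norm_num) hR₁pos hΔP (hrR₁ k) e
    rw [show 2 * r (k + 1) = 4 * r k by rw [hrsucc]; ring, hrsucc k]
    refine h.trans (le_of_eq ?_)
    ring
  have hstep : ∀ k, ‖Mv k - Mv (k + 1)‖ ≤ (A / R₁) / 2 ^ k := by
    intro k
    have hk : (A / R₁) / 2 ^ k = A / r k := by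
      rw [hr]; field_simp
    rw [hk]
    refine norm_le_of_forall_abs_inner_le (div_nonneg hA0 (hrpos k).le) fun e => ?_
    rw [inner_sub_left, hcomp, hcomp]
    refine (hAstep k e).trans (le_of_eq ?_)
    ring
  -- Step 2: the limit of the shell means
  obtain ⟨g, -, hg⟩ := exists_tendsto_of_norm_sub_succ_le hstep
  refine ⟨g, fun ε hε => ?_⟩
  -- Step 3: constants and the oscillation level `δ`
  obtain ⟨Λ₁, hΛ₁⟩ : ∃ Λ : ℝ, Λ = ∫ w : EuclideanSpace ℝ (Fin 3), |newtonFarLaplacian 1 2 w| := ⟨_, rfl⟩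
  have hΛ₁0 : 0 ≤ Λ₁ := by rw [hΛ₁]; exact integral_nonneg fun _ => abs_nonneg _
  set Cosc : ℝ := 2 * (3 * ν + a + ‖B‖ + M) + 18 * (a + ‖B‖) with hCosc
  have hCosc0 : 0 ≤ Cosc := by positivity
  have hden : 0 < 2 * (Λ₁ * Cosc + 1) := by positivity
  set δ : ℝ := ε / (2 * (Λ₁ * Cosc + 1)) with hδdef
  have hδ : 0 < δ := div_pos hε hden
  have hδbound : Λ₁ * (Cosc * δ) ≤ ε / 2 := by
    have h1 : Λ₁ * Cosc * ε ≤ (Λ₁ * Cosc + 1) * ε := by nlinarith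
    have h2 : Λ₁ * (Cosc * δ) = Λ₁ * Cosc * ε / (2 * (Λ₁ * Cosc + 1)) := by
      rw [hδdef]; ring
    rw [h2, div_le_iff₀ hden]
    nlinarith
  obtain ⟨Rδ, hRδ1, hRδ⟩ := exists_radius_decay hdecay hδ
  -- Step 4: the radius
  refine ⟨max (max (2 * Rδ) R₁) (8 * A / ε), fun y hy => ?_⟩
  have hyR₁ : R₁ ≤ ‖y‖ := ((le_max_right _ _).trans (le_max_left _ _)).trans hy
  have hyRδ : 2 * Rδ ≤ ‖y‖ := ((le_max_left _ _).trans (le_max_left _ _)).trans hy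
  have hyA : 8 * A / ε ≤ ‖y‖ := (le_max_right _ _).trans hy
  -- the dyadic shell containing `y`
  obtain ⟨k, hk1, hk2⟩ := exists_nat_pow_near (x := ‖y‖ / R₁)
    (by rwa [le_div_iff₀ hR₁pos, one_mul]) one_lt_two
  have hk1' : r k ≤ ‖y‖ := by
    rw [hr]; rwa [le_div_iff₀ hR₁pos] at hk1
  have hk2' : ‖y‖ ≤ 2 * r k := by
    rw [hr]
    rw [div_lt_iff₀ hR₁pos, pow_succ] at hk2
    linarith
  have hrδ : Rδ ≤ r k := by linarith
  -- near: `∇P(y)` vs the `k`-th shell mean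
  have hnear : ‖gradient P y - Mv k‖ ≤ Λ₁ * (Cosc * δ) := by
    refine norm_le_of_forall_abs_inner_le (mul_nonneg hΛ₁0 (mul_nonneg hCosc0 hδ.le)) fun e => ?_
    rw [inner_sub_left, hcomp, inner_gradient_left, abs_sub_comm]
    have hφc : Continuous fun z : EuclideanSpace ℝ (Fin 3) => fderiv ℝ P z e :=
      (hP1.continuous_fderiv one_ne_zero).clm_apply continuous_const
    have h := abs_shellMean_sub_le (hrpos k) hφc (v := fderiv ℝ P y e) (δ := Cosc * δ * ‖e‖)
      (fun w hw1 hw2 => abs_fderiv_pressure_sub_le_of_shell hν.le ha.le hB hU2 heq hM hδ.le hRδ1 hRδ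
        hrδ e hw1 hw2 hk1' hk2')
    rw [← hΛ₁] at h
    refine h.trans (le_of_eq ?_)
    ring
  -- far: the `k`-th shell mean vs the limit
  have hfar : ‖Mv k - g‖ ≤ ε / 2 := by
    refine (hg k).trans ?_
    have h2k : 2 * (A / R₁) / 2 ^ k = 2 * A / r k := by
      rw [hr]; field_simp
    rw [h2k, div_le_div_iff₀ (hrpos k) two_pos]
    have h8 : 8 * A ≤ ‖y‖ * ε := (div_le_iff₀ hε).1 hyA
    nlinarith [mul_le_mul_of_nonneg_right hk2' hε.le]
  calc ‖gradient P y - g‖ ≤ ‖gradient P y - Mv k‖ + ‖Mv k - g‖ := norm_sub_le_norm_sub_add_norm_sub _ _ _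
    _ ≤ ε / 2 + ε / 2 := add_le_add (hnear.trans hδbound) hfar
    _ = ε := by ring

end Profile

end FarFieldLimit

end Summit.NavierStokesRegularity.NavierStokesRegularity.Theorems.CoriolisHead

end
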